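import Literature.AlgebraicGeometry.Resolution.PrincipalizationOfProp44
import HarnessLib

/-!
# Embedded resolution of idealistic exponents on threefold stages ([CoP1] Prop. 4.4) and the
# decomposition of `CossartPiltant2019Principalization`

Topic: `Literature/AlgebraicGeometry/Resolution`. Fact decomposition (librarian, mode
`fact-decompose`, 2026-08-16) of the XL named fact
`Literature.AlgebraicGeometry.Resolution.CossartPiltant2019Principalization`
(`Principalization.lean`; Cossart–Piltant, J. Algebra 529 (2019), Prop. 4.4 = arXiv v1 Prop. 4.3:
principalization of a non-zero ideal sheaf on a regular excellent threefold by blowing ups along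
regular centres in the non-locally-principal loci).

The printed proof is [CoP1] = Cossart–Piltant, J. Algebra 320 (2008), §4: the proof of Prop. 4.2
(pp. 7–8) writes `I = H · J` with `H` invertible and `V(J)` of codimension `≥ 2`, and "using
induction on `μ`, proposition 4.2 is now a consequence of its rephrased version in proposition 4.4"
— embedded resolution of the idealistic exponent `E = (J, μ)`, `dim V(J) ≤ 1`, by a finite
composition of blowing ups with permissible centres (regular, inside `Σ = {ord_x J = μ}`). That
induction, the divisorial decomposition and the boundedness of the order are PROVED in the tree
(`exists_principalization_of_prop44`, `cossartPiltant2019Principalization_of_prop44`,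
`PrincipalizationOfProp44.lean`, over the notions `IsPermissibleSeq` and `idealOrder`), so the fact
splits into the single consequence child below (a notion + consequence pair whose notion is
already in the tree):

* `CossartPiltant2008_prop44` (CHILD, named fact) — [CoP1] Prop. 4.4 on the stages of
  Cossart–Piltant sequences over regular excellent threefolds, exactly the hypothesis `h44` of
  `cossartPiltant2019Principalization_of_prop44`;
* `CossartPiltant2019Principalization_holds_of` (ASSEMBLY, proved) —
  `CossartPiltant2008_prop44 → CossartPiltant2019Principalization`.

The child is strictly an intermediate result (Prop. 4.4 is about idealistic exponents `(J, μ)`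
with `V(J)` of codimension `≥ 2`, not about principalization) and does not restate the parent.
Its own printed proof ([CoP1] pp. 9–13: Lemma 4.3 (near and very near points, from Hironaka's
Thm. 2 of *Additive groups associated with points of a projective space*, Ann. of Math. 92 (1970)),
the algorithm 1–4, embedded resolution of curves and the generic-point argument, the exclusion of
infinite chains of near closed points for `τ = 2` ((12) and a formal curve `Γ ⊆ Σ`) and for
`τ = 1` (Lemma 4.5, the polygon `Δ(E; u₁, u₂; y)` prepared as in Cossart–Piltant 2019 /
[CoP3] Thm. II.3)) is the object of the ~110 proof files `NearPoints*.lean`,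
`HironakaDirectrix*.lean`, `NearChain*.lean`, `Polygon*.lean`, `FacePreparation*.lean`, … of this
directory (seat of the parent, 2026-08-15/16).

## Sources

* V. Cossart, O. Piltant, J. Algebra 320 (2008) 1051–1082, Prop. 4.2 (proof, pp. 7–8), Lemma 4.3,
  Prop. 4.4 and its proof (pp. 8–13), Lemma 4.5. [CossartPiltant2008]
* V. Cossart, O. Piltant, J. Algebra 529 (2019), Prop. 4.4 (arXiv:1412.0868 v1: Prop. 4.3).
  [CossartPiltant2019]
* H. Hironaka, Ann. of Math. 92 (1970) 327–334, Thm. 2. [Hironaka1970]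
-/

noncomputable section

open CategoryTheory CategoryTheory.Limits AlgebraicGeometry TopologicalSpace IsLocalRing

namespace Literature.AlgebraicGeometry.Resolution

universe u

open Scheme.IdealSheafData

/-- NAMED FACT (split child of `CossartPiltant2019Principalization`) — **[CoP1] Prop. 4.4:
embedded resolution of idealistic exponents with one-dimensional singular locus on regular
threefolds.** Cossart–Piltant, J. Algebra 320 (2008), Prop. 4.4, p. 9: "Let `X/k` be a regular
quasiprojective model of `K/k` and `E = (I, μ)` be an idealistic exponent on `X`, with
`dim V(I) ≤ 1`. There exists a finite composition of blowing ups `X =: X(0) ← X(1) ← ⋯ ← X(n)`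
with regular centers mapping to `V(I)` such that the singular locus `Σ(n)` of the transform `E(n)`
of `E` in `X(n)` is empty", made characteristic free on regular excellent threefolds by
Cossart–Piltant 2019 (Prop. 4.4 there, proof via [CoP3] Thm. II.3). Rendered, as in the hypothesis
`h44` of `cossartPiltant2019Principalization_of_prop44`, on the stages `ρ : X → S` of
Cossart–Piltant sequences (`IsRegularCentreBlowupSeq ρ I`) over a regular, excellent, integral
Noetherian scheme `S` of dimension `3` and `I ≠ 0`: for every ideal sheaf `J` on `X` with `V(J)` of
codimension `≥ 2` ("dimension `≤ 1`") and `μ ≥ 1` its maximal order (`ord_x J ≤ μ` everywhere,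
with equality somewhere) there are a permissible sequence `π : X' → X` for `(J, μ)`
(`IsPermissibleSeq π J μ J'`: blowing ups along regular integral centres inside `{ord = μ}`, `J'`
the weak transform) with `ord_x J' < μ` for every `x ∈ X'` ("`Σ(n) = ∅`").
[cite: CossartPiltant2008, Prop. 4.4] [cite: CossartPiltant2019, Prop. 4.4 (arXiv v1: Prop. 4.3)] -/
def CossartPiltant2008_prop44 : Prop :=
  ∀ (S : Scheme.{u}) [IsIntegral S] [IsNoetherian S], Scheme.IsRegular S →
    Scheme.IsExcellent S → topologicalKrullDim S = 3 → ∀ (I : S.IdealSheafData), I ≠ ⊥ →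
    ∀ (X : Scheme.{u}) (ρ : X ⟶ S) [IsIntegral X] [IsNoetherian X],
      IsRegularCentreBlowupSeq ρ I → ∀ (J : X.IdealSheafData) (μ : ℕ), 1 ≤ μ →
        (∀ x ∈ J.support, 1 < Order.coheight x) → (∀ x, idealOrder J x ≤ μ) →
        (∃ x, idealOrder J x = μ) →
        ∃ (X' : Scheme.{u}) (π : X' ⟶ X) (J' : X'.IdealSheafData),
          IsPermissibleSeq π J μ J' ∧ ∀ x, idealOrder J' x < μ

/-- ASSEMBLY of the split of `CossartPiltant2019Principalization` (PROVED): **Cossart–Piltant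
2019, Prop. 4.4 from [CoP1] Prop. 4.4** — the divisorial decomposition `I = H · J`, the bound on
the order of `J` and the induction on `μ` of [CoP1], proof of Prop. 4.2 (pp. 7–8), all proved in
`PrincipalizationOfProp44.lean` (`cossartPiltant2019Principalization_of_prop44`).
[cite: CossartPiltant2008, Prop. 4.2 (proof)] -/
theorem CossartPiltant2019Principalization_holds_of (h44 : CossartPiltant2008_prop44.{u}) :
    CossartPiltant2019Principalization.{u} :=
  cossartPiltant2019Principalization_of_prop44 h44

end Literature.AlgebraicGeometry.Resolution

end
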